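import Literature.MathematicalPhysics.QuantumFieldTheory.Balaban1983to89.B3Ineq213ZeroBoxDiffLines
import Literature.MathematicalPhysics.QuantumFieldTheory.Balaban1983to89.B3Prop21Model

/-!
# B3 (2.6)–(2.7) and (1.33) for the TOTAL amplitude of the zero-field box line class: the lines of p19's total
# amplitude `Amp.Etot` ARE the box propagators `G_k(□,0)` and their lattice derivatives

T. Bałaban, *(Higgs)₂,₃ quantum fields in a finite volume. III. Renormalization*, Commun. Math. Phys. **88** (1983)
411–445 [Balaban1983Higgs3], Sect. 2, pp. 424–427 [PDF 14–17] (journal page = PDF page + 410; held text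
`paper:balaban1983-higgs-2-3-quantum-fields-finite-volume`).

statement-level skeleton of published theorems with citation tags; proofs where landed; nothing here is a claim about
the Yang–Mills mass gap

Cell `lit-balaban` (HOME `run/shared/lean/pub/lit-balaban/`), Phase-2 proof seat `lit-balaban-p03` gen 5, rows
**B3.Eq2.13-2.14**, **B3.Eq2.6**, **B3.Eq2.10** (owner r15).  THEOREMS plus one definition with body (`fullK`); imports this
seat's `B3Ineq213ZeroBoxDiffLines` (the class with differentiated legs, `dlineK`, `dboxAmp`) and p19's `B3Prop21Model`
(`Amp.Etot`, `Amp.Etot_eq_sum_E` = (2.7), `Amp.bound133_total` = (1.33) for the total amplitude).  No new `def … : Prop`;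
no existing declaration is modified.

## What is printed

p. 424 [PDF 14]: *"we get G_k(Ω,B̃) = Σ_{j=0}^{k−1} G^η_{(j)}(Ω,B̃) (2.6) … Thus we get a sum of new expressions obtained by
replacing in each line l of the graph G′ the corresponding propagator by a propagator G^η_{(j_l)}, 0 ≦ j_l ≦ k−1. … We can
write E(G′) as a sum Σ_j E(G′(j)). (2.7)"*; p. 420 (1.33).

## What this file proves

p19's TOTAL amplitude `Amp.Etot = Σ_{x_v ∈ □(v)} Π_v η^d u_v(x_v) Π_l Σ_{t<k} K_l(t; x_{v_l}, x_{v′_l})` of the amplitude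
`dboxAmp` of file 4 has, as its line factors, the GENUINE zero-field box propagator and its lattice derivatives:
`Σ_{t<k} K_l(t; x, x′) = η^{−(d+1)}·𝒟_l G_k(□,0; x, x′)` (`sum_dlineK`; `fullK` = the value / forward η-difference in the
first argument / in the second / in both of `η^{−(d+1)}G_k(□,0)` = gen-4's `B4Thm110ZeroBox.Gfine ℓ k M k a m²` in
`η^d`-weighted kernel units, zero outside `□`) — this is (2.6) `G_k(□,0) = Σ_{j<k} G^η_{(j)}` (`B3Ineq210ZeroBox.sum_piece`)
differenced termwise; hence **`Etot_dboxAmp`**: `Etot = Σ_{x_v ∈ □(v)} Π_v η^d u_v(x_v) Π_l η^{−(d+1)}𝒟_l G_k(□,0; x_{v_l},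
x_{v′_l})`, the amplitude of the graph WITH ITS ACTUAL PROPAGATOR LINES, and (2.7) for it is p19's `Etot_eq_sum_E`; and
**`abs_amplitude_le`**: (1.33) for that amplitude (p19's `bound133_total`, the line hypothesis discharged in file 4, given
Proposition 2.2's degree positivity along every ordering), with NO line hypothesis.

Scope as in files 3–4 (`A = B̃ = 0`, `Ω = □`, scalar lines, vertex side as data).
-/

namespace Literature.MathematicalPhysics.QuantumFieldTheory.Balaban1983to89.B3Ineq213ZeroBoxTotal

open Finset
open Literature.MathematicalPhysics.QuantumFieldTheory.Balaban1983to89.B3Ineq215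
open Literature.MathematicalPhysics.QuantumFieldTheory.Balaban1983to89.B3Ineq213
open Literature.MathematicalPhysics.QuantumFieldTheory.Balaban1983to89.B3Ineq210ZeroBox
open Literature.MathematicalPhysics.QuantumFieldTheory.Balaban1983to89.B3Ineq213ZeroBoxLines
open Literature.MathematicalPhysics.QuantumFieldTheory.Balaban1983to89.B3Ineq213ZeroBoxDiffLines
open Literature.MathematicalPhysics.QuantumFieldTheory.Balaban1983to89.B4Reflection242 (boxDom)
open Literature.MathematicalPhysics.QuantumFieldTheory.Balaban1983to89.B4Thm110ZeroBox (Nf Gfine)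

noncomputable section

variable {d : ℕ}

/-! ## §1 The full line kernels: `η^{−(d+1)}G_k(□,0)` and its lattice derivatives -/

/-- **The full line kernel** of a scalar line with optional derivatives at its legs: the value, the forward η-difference in the
first argument, in the second, or the mixed second difference of `η^{−(d+1)}·G_k(□,0)` (`𝒢_k = B4Thm110ZeroBox.Gfine ℓ k M k a m²`,
the zero-field Neumann box propagator after `k` steps, in `η^d`-weighted kernel units; `η^{−1}×` per differentiation), `0` if a
position involved is outside `□`. [cite: Balaban1983Higgs3, (2.6) p.424, (1.16) p.414] -/
def fullK (ℓ k : ℕ) (M : Fin (d + 1) → ℕ) (a m2 : ℝ) :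
    Option (Fin (d + 1)) → Option (Fin (d + 1)) → (Fin (d + 1) → ℕ) → (Fin (d + 1) → ℕ) → ℝ
  | none, none => fun x x' =>
      if h : InBox (Nf ℓ k M) x ∧ InBox (Nf ℓ k M) x' then
        ((((ℓ + 1) ^ k : ℕ) : ℝ)) ^ (d + 1) * Gfine ℓ k M k a m2 (site x h.1) (site x' h.2)
      else 0
  | some μ, none => fun x x' =>
      if h : InBox (Nf ℓ k M) x ∧ InBox (Nf ℓ k M) (shiftPos x μ) ∧ InBox (Nf ℓ k M) x' then
        ((((ℓ + 1) ^ k : ℕ) : ℝ)) ^ (d + 1) * (((((ℓ + 1) ^ k : ℕ) : ℝ))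
          * (Gfine ℓ k M k a m2 (site (shiftPos x μ) h.2.1) (site x' h.2.2)
              - Gfine ℓ k M k a m2 (site x h.1) (site x' h.2.2)))
      else 0
  | none, some ν => fun x x' =>
      if h : InBox (Nf ℓ k M) x ∧ InBox (Nf ℓ k M) x' ∧ InBox (Nf ℓ k M) (shiftPos x' ν) then
        ((((ℓ + 1) ^ k : ℕ) : ℝ)) ^ (d + 1) * (((((ℓ + 1) ^ k : ℕ) : ℝ))
          * (Gfine ℓ k M k a m2 (site x h.1) (site (shiftPos x' ν) h.2.2)
              - Gfine ℓ k M k a m2 (site x h.1) (site x' h.2.1)))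
      else 0
  | some μ, some ν => fun x x' =>
      if h : (InBox (Nf ℓ k M) x ∧ InBox (Nf ℓ k M) (shiftPos x μ)) ∧
          (InBox (Nf ℓ k M) x' ∧ InBox (Nf ℓ k M) (shiftPos x' ν)) then
        ((((ℓ + 1) ^ k : ℕ) : ℝ)) ^ (d + 1) * (((((ℓ + 1) ^ k : ℕ) : ℝ)) ^ 2
          * ((Gfine ℓ k M k a m2 (site (shiftPos x μ) h.1.2) (site (shiftPos x' ν) h.2.2)
              - Gfine ℓ k M k a m2 (site x h.1.1) (site (shiftPos x' ν) h.2.2))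
            - (Gfine ℓ k M k a m2 (site (shiftPos x μ) h.1.2) (site x' h.2.1)
              - Gfine ℓ k M k a m2 (site x h.1.1) (site x' h.2.1))))
      else 0

/-- (2.6) entrywise: `Σ_{t<k} G^η_{(t)}(y, y′) = 𝒢_k(y, y′)`. [cite: Balaban1983Higgs3, (2.6) p.424] -/
theorem sum_piece_apply {ℓ k : ℕ} (hk : 1 ≤ k) {M : Fin (d + 1) → ℕ} {a m2 : ℝ} (y y' : ↥(boxDom (Nf ℓ k M))) :
    ∑ t ∈ Finset.range k, piece ℓ k M t a m2 y y' = Gfine ℓ k M k a m2 y y' := by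
  rw [← sum_piece hk, Matrix.sum_apply]

/-- **(2.6) differenced termwise: the scale pieces of a line sum to its full kernel**, `Σ_{t<k} K_l(t; x, x′) =
η^{−(d+1)}𝒟_l G_k(□,0; x, x′)`. [cite: Balaban1983Higgs3, (2.6) p.424] -/
theorem sum_dlineK {ℓ k : ℕ} (hk : 1 ≤ k) (M : Fin (d + 1) → ℕ) (a m2 : ℝ) (μo νo : Option (Fin (d + 1)))
    (x x' : Fin (d + 1) → ℕ) :
    ∑ t ∈ Finset.range k, dlineK ℓ k M a m2 μo νo t x x' = fullK ℓ k M a m2 μo νo x x' := by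
  cases μo with
  | none =>
    cases νo with
    | none =>
      show ∑ t ∈ Finset.range k, lineK ℓ k M a m2 t x x' = dite _ _ _
      split_ifs with h
      · exact sum_lineK hk h.1 h.2
      · exact Finset.sum_eq_zero fun t _ => lineK_of_not_inBox t h
    | some ν =>
      show ∑ t ∈ Finset.range k, dite _ _ _ = dite _ _ _
      split_ifs with h
      · rw [← Finset.mul_sum, ← Finset.mul_sum, Finset.sum_sub_distrib, sum_piece_apply hk, sum_piece_apply hk]
      · exact Finset.sum_const_zero
  | some μ =>
    cases νo with
    | none =>
      show ∑ t ∈ Finset.range k, dite _ _ _ = dite _ _ _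
      split_ifs with h
      · rw [← Finset.mul_sum, ← Finset.mul_sum, Finset.sum_sub_distrib, sum_piece_apply hk, sum_piece_apply hk]
      · exact Finset.sum_const_zero
    | some ν =>
      show ∑ t ∈ Finset.range k, dite _ _ _ = dite _ _ _
      split_ifs with h
      · rw [← Finset.mul_sum, ← Finset.mul_sum, Finset.sum_sub_distrib, Finset.sum_sub_distrib, Finset.sum_sub_distrib,
          sum_piece_apply hk, sum_piece_apply hk, sum_piece_apply hk, sum_piece_apply hk]
      · exact Finset.sum_const_zero

/-- the same with the sum over `Fin k` (the form of p19's `Amp.Etot`). [cite: Balaban1983Higgs3, (2.6) p.424] -/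
theorem sum_dlineK_fin {ℓ k : ℕ} (hk : 1 ≤ k) (M : Fin (d + 1) → ℕ) (a m2 : ℝ) (μo νo : Option (Fin (d + 1)))
    (x x' : Fin (d + 1) → ℕ) :
    ∑ t : Fin k, dlineK ℓ k M a m2 μo νo (t : ℕ) x x' = fullK ℓ k M a m2 μo νo x x' := by
  rw [Fin.sum_univ_eq_sum_range (fun t => dlineK ℓ k M a m2 μo νo t x x') k]
  exact sum_dlineK hk M a m2 μo νo x x'

/-! ## §2 The total amplitude with its actual propagator lines, and (1.33) for it -/

variable {V : Type} [Fintype V] [DecidableEq V] {m : ℕ}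

section Total

variable (Γ : DLineGraph V m d) (ℓ : ℕ) (hℓ : 1 ≤ ℓ) (amin aplus m2plus : ℝ) (ha : 0 < amin) {k : ℕ} (hk : 1 ≤ k)
  {a m2 : ℝ} (h1 : amin ≤ a) (h2 : a ≤ aplus) (h3 : 0 ≤ m2) (h4 : m2 ≤ m2plus) (M : Fin (d + 1) → ℕ)
  (hM : ∀ i, 1 ≤ M i) (box : V → Fin (d + 1) → ℕ) (P : VertexData V d ℓ k Γ.etaPow)

/-- **The total amplitude of `dboxAmp` is the graph amplitude with its ACTUAL propagator lines**:
`Etot = Σ_{x_v ∈ □(v)} Π_v η^{d+1} u_v(x_v) · Π_l η^{−(d+1)}𝒟_l G_k(□,0; x_{v_l}, x_{v′_l})` ((2.6) per line inside p19's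
`Etot`; (2.7) for it is p19's `Amp.Etot_eq_sum_E`). [cite: Balaban1983Higgs3, (2.6) p.424, (2.7) p.424] -/
theorem Etot_dboxAmp :
    (dboxAmp Γ ℓ hℓ amin aplus m2plus ha hk h1 h2 h3 h4 M hM box P).Etot
      = ∑ x ∈ boxPositions (ℓ + 1) k box,
          (∏ v, (((((ℓ + 1 : ℕ) : ℝ)) ^ k)⁻¹) ^ (d + 1) * P.u v (x v))
            * ∏ l, fullK ℓ k M a m2 (Γ.dSrc l) (Γ.dTgt l) (x (Γ.src l)) (x (Γ.tgt l)) := by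
  unfold Amp.Etot
  refine Finset.sum_congr rfl fun x _ => ?_
  congr 1
  exact Finset.prod_congr rfl fun l _ => sum_dlineK_fin hk M a m2 (Γ.dSrc l) (Γ.dTgt l) _ _

/-- **(2.7) for the amplitude with actual propagator lines**: it is the sum over all scale assignments of the scale-sliced
amplitudes `E_j` (p19's `Etot_eq_sum_E`, restated through `Etot_dboxAmp`). [cite: Balaban1983Higgs3, (2.7) p.424] -/
theorem amplitude_eq_sum_E :
    ∑ x ∈ boxPositions (ℓ + 1) k box,
        (∏ v, (((((ℓ + 1 : ℕ) : ℝ)) ^ k)⁻¹) ^ (d + 1) * P.u v (x v))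
          * ∏ l, fullK ℓ k M a m2 (Γ.dSrc l) (Γ.dTgt l) (x (Γ.src l)) (x (Γ.tgt l))
      = ∑ j : Fin m → Fin k, (dboxAmp Γ ℓ hℓ amin aplus m2plus ha hk h1 h2 h3 h4 M hM box P).E fun l => (j l : ℕ) := by
  rw [← Etot_dboxAmp]
  exact (dboxAmp Γ ℓ hℓ amin aplus m2plus ha hk h1 h2 h3 h4 M hM box P).Etot_eq_sum_E

/-- **(1.33) for the amplitude with actual propagator lines, NO line hypothesis** (p19's `Amp.bound133_total` for `dboxAmp`:
the sum over the orderings l̃ of (2.13) + (2.15), given Proposition 2.2's positivity of the degrees of the non-trivial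
subgraphs along every ordering; constants: `C^m`, the (2.15) constants, and the prefactor `e^{d_v}λ^{d_s}e^{−½δ₁d({□(v)})}ΠN^ΦΠN^A`).
[cite: Balaban1983Higgs3, (1.33) p.420, (2.13) p.426, Prop. 2.2 p.428] -/
theorem abs_amplitude_le
    (hpos : ∀ σ : Equiv.Perm (Fin m), ∀ i, i ≤ m →
      ∀ b ∈ (relabelCounts (dboxCounts Γ ℓ hℓ amin aplus m2plus ha) σ).toModel.reps i,
        (relabelCounts (dboxCounts Γ ℓ hℓ amin aplus m2plus ha) σ).toModel.Nontriv i b →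
          0 < (relabelCounts (dboxCounts Γ ℓ hℓ amin aplus m2plus ha) σ).toModel.D i b) :
    |∑ x ∈ boxPositions (ℓ + 1) k box,
        (∏ v, (((((ℓ + 1 : ℕ) : ℝ)) ^ k)⁻¹) ^ (d + 1) * P.u v (x v))
          * ∏ l, fullK ℓ k M a m2 (Γ.dSrc l) (Γ.dTgt l) (x (Γ.src l)) (x (Γ.tgt l))|
      ≤ (∏ _l : Fin m, dconst d ℓ hℓ amin aplus m2plus ha)
        * (∑ σ : Equiv.Perm (Fin m), (relabelCounts (dboxCounts Γ ℓ hℓ amin aplus m2plus ha) σ).toModel.const215)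
        * (dboxAmp Γ ℓ hℓ amin aplus m2plus ha hk h1 h2 h3 h4 M hM box P).pref := by
  rw [← Etot_dboxAmp]
  exact (dboxAmp Γ ℓ hℓ amin aplus m2plus ha hk h1 h2 h3 h4 M hM box P).bound133_total hpos

/-- the prefactor of (1.33) for `dboxAmp`, explicitly: `e^{Σd_v} λ^{Σd_s} e^{−(δ₁/2)·d({□(v)})} ΠN^Φ ΠN^A` with `δ₁` the rate of
`dlineK_le`. [cite: Balaban1983Higgs3, (1.33) p.420] -/
theorem pref_dboxAmp :
    (dboxAmp Γ ℓ hℓ amin aplus m2plus ha hk h1 h2 h3 h4 M hM box P).pref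
      = P.eRun ^ (∑ v, P.dv v) * P.lamRun ^ (∑ v, P.ds v)
          * Real.exp (-(ddelta1 d ℓ hℓ amin aplus m2plus ha / 2 * boxTreeLen (ℓ + 1) k box))
          * (∏ v, P.NPhi v) * ∏ v, P.NA v := rfl

end Total

end

end Literature.MathematicalPhysics.QuantumFieldTheory.Balaban1983to89.B3Ineq213ZeroBoxTotal
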